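import Summits.BirchSwinnertonDyer.BirchSwinnertonDyer.Theorems.AdditiveBranchIMCGordTwoRankOneHeegnerKolyvaginGss2RecordsFieldA
import HarnessLib

/-!
# Route `AdditiveBranchIMC` (rung K1), crux `GordTwoRankOne` (item 19358) — the Heegner–Kolyvagin road, Part 24g (= 24f continued):
# the Heegner FIELD of the seven GSS2 kernel records CONSTRUCTED and its Heegner HYPOTHESIS DECIDED in the kernel —
# records with the binders `K`, `hK`, `hdK`, `hHN` (and `htam`, Part 24e) REMOVED
# (cell `bsd-addord`, second prover lane `bsd-addord-k1-c3x`, gen 9; `--supports` only)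

HONEST FRAMING. THEOREMS ONLY (no definition, no named fact, no `sorry`); PER PAIR — NOT a class theorem; nothing is booked by this
file; crux 19358 stays OPEN at class level; BSD is not proved by any of this. Parts 24a–e (`…Gss2Records{A,B,C,D,Tam}`) left the
Heegner field of each row as DISPLAYED data: `(K) (hK : IsImaginaryQuadratic K) (hdK : d_K = d) (hHN : every prime of N_E splits in K)`.
Both are decidable from the integer model and the tree already holds the tools (bsd-jet's depth-table ROW KIT
`KolyvaginDepthDoorDepthTableRowKit`, consumed BY NAME): `KolyvaginDepthDoor.exists_isImaginaryQuadratic_discr_eq` (an imaginary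
quadratic field of prescribed fundamental discriminant EXISTS — Marcus Ch. 2 Thm. 1, tree `Quadratic.exists_numberField_discr_eq`) and
`KolyvaginDepthDoor.satisfiesHeegnerHypothesis_conductorNorm_of_intModel` (the Heegner hypothesis for `N_E` from the Kronecker symbols
`(d/q) = 1` at the primes `q ∣ Δ(E₀)` — decomposition law, tree `satisfiesHeegnerHypothesis_iff_kronecker`; `q ∣ N_E ⇒ q ∣ Δ_min`).
Part 24f (`…Gss2RecordsFieldA`, rows 182853c1 228897c1 250065g1 355338h1) adds the list bookkeeping lemma `forall_prime_dvd_of_natAbs_eq_prod` (the primes of `Δ` from a kernel-checked complete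
factorisation) and this file continues, for the rows 409248cy1 439794p1 205128l1, with `heegner_g<label>` (the Heegner hypothesis for `(N_E, K)` for EVERY imaginary quadratic `K` with
`d_K = d`: Jacobi symbols by `norm_num`, `d ≡ 1 (mod 8)` at `q = 2`), `exists_field_g<label>` (such a `K` exists: `d` is a negative
fundamental discriminant, squarefreeness by `decide`), and the record **`bsdp_g<label>_3_ker`** = Part 24e's `bsdp_g<label>_3_tam` with
the field binders DISCHARGED. What a booking desk still prices per row (displayed): the published facts {hGZ, hKo, hB, hGZK, hmod, hnf,
hMz, hAU, hC2}; Cremona's `r_an = 1` (`hr`) and `#Ш_an = 9` (`hq`/`hv`); the twist datum `L(E^{(d)},1) ≠ 0` (`hLt`) and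
`#Ш_an(Wd) = qd`, `ord₃ qd ≤ 0` (`hqd`/`hvd`) — two engines, PARI j293586 + PARI-free j294995; the LB3SUB line `hS`/`hcardS` (`#S = 27`,
j293463/j293581). Everything else — the three minimal models, additivity and the (G) ∧ ss cell at `3`, `ρ̄₃` onto, `∏ c_ℓ`, the Heegner
field and hypothesis, both twist identities — is decided in the kernel.

References: [GrossLMS1991] §1 (p. 235); [Marcus1977] Ch. 2 Thm. 1, Ch. 3 Thm. 25; [SilvermanAEC2009] VII.5 Prop. 5.1 (a);
[JetchevSkinnerWan2017] §7.4; [McCallumLMS1991] §1; [SchaeferStoll2004]; [Miller2011LMS] Def. 1.1; [Cremona2006] Table 1.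
-/

set_option autoImplicit false
set_option linter.dupNamespace false
noncomputable section
open scoped Classical NumberField
open WeierstrassCurve NumberField IsDedekindDomain Field
  Literature.NumberTheory.DiophantineGeometry Literature.NumberTheory.EllipticCurves
  Literature.NumberTheory.EllipticCurves.ModularForms Literature.NumberTheory.EllipticCurves.Rank1Residual
  Literature.NumberTheory.EllipticCurves.Rank1Residual.Typed Literature.NumberTheory.Automorphic
  Summit.BirchSwinnertonDyer.BirchSwinnertonDyer.Rank1Residual.IntModel
  Summit.BirchSwinnertonDyer.Rank1Residual Summit.BirchSwinnertonDyer.Rank1Residual.Additive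
  Summit.BirchSwinnertonDyer.BirchSwinnertonDyer.Theses.AdditiveKolyvaginRoad
  Summit.BirchSwinnertonDyer.BirchSwinnertonDyer.Theorems.AdditiveKolyvaginKernel
  Summit.BirchSwinnertonDyer.BirchSwinnertonDyer.Theorems

namespace Summit.BirchSwinnertonDyer.BirchSwinnertonDyer.Theorems.AdditiveBranchIMCGordTwoRankOne.HeegnerKolyvagin

/-! ### `409248cy1` — Heegner field `ℚ(√-335)`: `d_K = -335` fundamental; primes of `Δ` = `[2, 3, 7, 29]` all split (`-335 ≡ 1 (mod 8)`, `(-335/3) = +1`, `(-335/7) = +1`, `(-335/29) = +1`) -/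

/-- **The Heegner hypothesis for `(N_E, K)`, `E = 409248cy1`, for EVERY imaginary quadratic `K` with `d_K = -335`**, IN THE KERNEL: every prime of
`N_E` divides `Δ_min = Δ(E₀)` (`|Δ| = 2^12·3^6·7^2·29^1` kernel-checked), and at each of them the decomposition law gives a split prime
(`-335 ≡ 1 (mod 8)`, `(-335/3) = +1`, `(-335/7) = +1`, `(-335/29) = +1`; Jacobi symbols by `norm_num`) — bsd-jet's `KolyvaginDepthDoor.satisfiesHeegnerHypothesis_conductorNorm_of_intModel`.
[cite: GrossLMS1991, §1 (p. 235)] [cite: Marcus1977, Ch. 3 Thm. 25] [cite: SilvermanAEC2009, VII.5 Prop. 5.1 (a)] [cite: Cremona2006, Table 1 (Cremona label 409248cy1)] -/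
theorem heegner_g409248cy1 (K : Type) [Field K] [NumberField K] (hK : IsImaginaryQuadratic K) (hdK : NumberField.discr K = -335) :
    haveI := isElliptic_g409248cy1; haveI := isGloballyMinimal_g409248cy1
    SatisfiesHeegnerHypothesis ((⟨0, 0, 0, -626472, 190853712⟩ : WeierstrassCurve ℚ).conductorNorm ℤ) K := by
  haveI := isElliptic_g409248cy1
  haveI := isGloballyMinimal_g409248cy1
  have hIW : integralModelInt (⟨0, 0, 0, -626472, 190853712⟩ : WeierstrassCurve ℚ) = (⟨0, 0, 0, -626472, 190853712⟩ : WeierstrassCurve ℤ) :=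
    integralModelInt_eq_of_map_eq _ (map_mk_int 0 0 0 (-626472) 190853712)
  refine KolyvaginDepthDoor.satisfiesHeegnerHypothesis_conductorNorm_of_intModel hIW K hK.1 hdK
    (forall_prime_dvd_of_natAbs_eq_prod [(2, 12), (3, 6), (7, 2), (29, 1)] (by decide +kernel)
      (by intro qe hqe; simp only [List.mem_cons, List.not_mem_nil, or_false] at hqe
          rcases hqe with rfl | rfl | rfl | rfl <;> norm_num)
      (by intro qe hqe; simp only [List.mem_cons, List.not_mem_nil, or_false] at hqe
          rcases hqe with rfl | rfl | rfl | rfl <;> norm_num))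

/-- **An imaginary quadratic field with `d_K = -335` EXISTS** (`-335` is a negative fundamental discriminant; squarefreeness by `decide`) —
bsd-jet's `KolyvaginDepthDoor.exists_isImaginaryQuadratic_discr_eq` (Marcus Ch. 2 Thm. 1). [cite: Marcus1977, Ch. 2 Thm. 1] [cite: Cremona2006, Table 1 (Cremona label 409248cy1)] -/
theorem exists_field_g409248cy1 :
    ∃ (K : Type) (_ : Field K) (_ : NumberField K), IsImaginaryQuadratic K ∧ NumberField.discr K = -335 :=
  KolyvaginDepthDoor.exists_isImaginaryQuadratic_discr_eq (by norm_num)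
    (Or.inl ⟨by norm_num, Int.squarefree_natAbs.mp (by decide +kernel), by norm_num⟩)

/-- **`BSD(E,3)` for `E = 409248cy1`, Heegner field and Tamagawa binders DISCHARGED** — the GSS2 kernel record in its leanest form: Part 24e's
`bsdp_g409248cy1_3_tam` with `K := ` a field of discriminant `-335` (`exists_field_g409248cy1`) and the Heegner hypothesis `heegner_g409248cy1`.
DISPLAYED (all that a desk prices): the published facts hGZ hKo hB hGZK hmod hnf (+ cite-only hMz hAU hC2); Cremona's `r_an = 1` (`hr`) and
`#Ш_an = 9` (`hq`/`hv`, `ord₃ ≤ 2`); the twist datum `L(E^{(-335)},1) ≠ 0` (`hLt`) and `#Ш_an(Wd) = qd`, `ord₃ qd ≤ 0` (`hqd`/`hvd`) for the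
minimal twist model `Wd = [0, 0, 0, -70305820200, -7175216872782000]` (two engines: PARI j293586, PARI-free j294995 — `#Ш_an(Wd) = 4`); the LB3SUB certificate line
`S ≤ Sel^(3)(E/ℚ)`, `#S = 27` (`hS`/`hcardS`; j293463/j293581). IN THE KERNEL: everything else (Parts 24a–e: models, minimality, `Addv`,
(G) ∧ ss, `ρ̄₃` onto, `∏ c_ℓ = 4`, twist identities; here: the field and the Heegner hypothesis). Per pair; nothing booked.
[cite: JetchevSkinnerWan2017, §7.4.1–7.4.3 (pp. 29–31)] [cite: McCallumLMS1991, §1 Theorem (Kolyvagin), p. 296] [cite: GrossLMS1991, §1 (p. 235)]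
[cite: SilvermanAEC2009, Thm. X.4.2(a)] [cite: SchaeferStoll2004, §1 and §5] [cite: Miller2011LMS, §1 and Def. 1.1] [cite: Cremona2006, Table 1 (Cremona label 409248cy1)] -/
theorem bsdp_g409248cy1_3_ker
    (hGZ : ∀ (N : ℕ) [NeZero N] (W : WeierstrassCurve ℚ) (K : Type) [Field K] [NumberField K],
      gross_zagier N W K)
    (hKo : ∀ (N : ℕ) [NeZero N] (W : WeierstrassCurve ℚ) (K : Type) [Field K] [NumberField K],
      kolyvagin N W K)
    (hB : ∀ (N : ℕ) [NeZero N] (W : WeierstrassCurve ℚ) (K : Type) [Field K] [NumberField K],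
      Kolyvagin1990_padicValNat_card_sha_le N W K)
    (hGZK : rank_eq_analyticRank_of_analyticRank_le_one) (hmod : hasEntireLFunction_rat)
    (hnf : exists_isNewformOf) (hMz : mazur_not_dvd_maninConstant_of_odd)
    (hAU : abbesUllmo_not_dvd_maninConstant_of_not_dvd_level)
    (hC2 : cesnavicius_not_two_dvd_maninConstant_of_two_dvd_level)
    {W : WeierstrassCurve ℚ} [W.IsElliptic] [W.IsGloballyMinimal] (hWeq : W = ⟨0, 0, 0, -626472, 190853712⟩)
    (hr : W.analyticRank = 1) (hLt : (W.quadraticTwist (-335 : ℚ)).entireLFunction 1 ≠ 0)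
    {Wd : WeierstrassCurve ℚ} [Wd.IsElliptic] [Wd.IsGloballyMinimal] (hWdeq : Wd = ⟨0, 0, 0, -70305820200, -7175216872782000⟩)
    {qd : ℚ} (hqd : shaAn Wd = (qd : ℂ)) (hvd : padicValRat 3 qd ≤ 0)
    {S : AddSubgroup (W.galH1Torsion (3 : ℤ))} (hS : S ≤ W.selmerGroup (3 : ℤ)) (hcardS : Nat.card S = 27)
    {q : ℚ} (hq : shaAn W = (q : ℂ)) (hv : padicValRat 3 q ≤ 2) : BSDp W 3 := by
  obtain ⟨K, _, _, hK, hdK⟩ := exists_field_g409248cy1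
  have hHN : SatisfiesHeegnerHypothesis (W.conductorNorm ℤ) K := by subst hWeq; exact heegner_g409248cy1 K hK hdK
  exact bsdp_g409248cy1_3_tam hGZ hKo hB hGZK hmod hnf hMz hAU hC2 hWeq hr K hK hdK hHN hLt hWdeq hqd hvd hS hcardS hq hv

/-! ### `439794p1` — Heegner field `ℚ(√-95)`: `d_K = -95` fundamental; primes of `Δ` = `[2, 3, 53, 461]` all split (`-95 ≡ 1 (mod 8)`, `(-95/3) = +1`, `(-95/53) = +1`, `(-95/461) = +1`) -/

/-- **The Heegner hypothesis for `(N_E, K)`, `E = 439794p1`, for EVERY imaginary quadratic `K` with `d_K = -95`**, IN THE KERNEL: every prime of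
`N_E` divides `Δ_min = Δ(E₀)` (`|Δ| = 2^13·3^6·53^1·461^2` kernel-checked), and at each of them the decomposition law gives a split prime
(`-95 ≡ 1 (mod 8)`, `(-95/3) = +1`, `(-95/53) = +1`, `(-95/461) = +1`; Jacobi symbols by `norm_num`) — bsd-jet's `KolyvaginDepthDoor.satisfiesHeegnerHypothesis_conductorNorm_of_intModel`.
[cite: GrossLMS1991, §1 (p. 235)] [cite: Marcus1977, Ch. 3 Thm. 25] [cite: SilvermanAEC2009, VII.5 Prop. 5.1 (a)] [cite: Cremona2006, Table 1 (Cremona label 439794p1)] -/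
theorem heegner_g439794p1 (K : Type) [Field K] [NumberField K] (hK : IsImaginaryQuadratic K) (hdK : NumberField.discr K = -95) :
    haveI := isElliptic_g439794p1; haveI := isGloballyMinimal_g439794p1
    SatisfiesHeegnerHypothesis ((⟨1, -1, 0, -412053, -101704843⟩ : WeierstrassCurve ℚ).conductorNorm ℤ) K := by
  haveI := isElliptic_g439794p1
  haveI := isGloballyMinimal_g439794p1
  have hIW : integralModelInt (⟨1, -1, 0, -412053, -101704843⟩ : WeierstrassCurve ℚ) = (⟨1, -1, 0, -412053, -101704843⟩ : WeierstrassCurve ℤ) :=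
    integralModelInt_eq_of_map_eq _ (map_mk_int 1 (-1) 0 (-412053) (-101704843))
  refine KolyvaginDepthDoor.satisfiesHeegnerHypothesis_conductorNorm_of_intModel hIW K hK.1 hdK
    (forall_prime_dvd_of_natAbs_eq_prod [(2, 13), (3, 6), (53, 1), (461, 2)] (by decide +kernel)
      (by intro qe hqe; simp only [List.mem_cons, List.not_mem_nil, or_false] at hqe
          rcases hqe with rfl | rfl | rfl | rfl <;> norm_num)
      (by intro qe hqe; simp only [List.mem_cons, List.not_mem_nil, or_false] at hqe
          rcases hqe with rfl | rfl | rfl | rfl <;> norm_num))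

/-- **An imaginary quadratic field with `d_K = -95` EXISTS** (`-95` is a negative fundamental discriminant; squarefreeness by `decide`) —
bsd-jet's `KolyvaginDepthDoor.exists_isImaginaryQuadratic_discr_eq` (Marcus Ch. 2 Thm. 1). [cite: Marcus1977, Ch. 2 Thm. 1] [cite: Cremona2006, Table 1 (Cremona label 439794p1)] -/
theorem exists_field_g439794p1 :
    ∃ (K : Type) (_ : Field K) (_ : NumberField K), IsImaginaryQuadratic K ∧ NumberField.discr K = -95 :=
  KolyvaginDepthDoor.exists_isImaginaryQuadratic_discr_eq (by norm_num)
    (Or.inl ⟨by norm_num, Int.squarefree_natAbs.mp (by decide +kernel), by norm_num⟩)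

/-- **`BSD(E,3)` for `E = 439794p1`, Heegner field and Tamagawa binders DISCHARGED** — the GSS2 kernel record in its leanest form: Part 24e's
`bsdp_g439794p1_3_tam` with `K := ` a field of discriminant `-95` (`exists_field_g439794p1`) and the Heegner hypothesis `heegner_g439794p1`.
DISPLAYED (all that a desk prices): the published facts hGZ hKo hB hGZK hmod hnf (+ cite-only hMz hAU hC2); Cremona's `r_an = 1` (`hr`) and
`#Ш_an = 9` (`hq`/`hv`, `ord₃ ≤ 2`); the twist datum `L(E^{(-95)},1) ≠ 0` (`hLt`) and `#Ш_an(Wd) = qd`, `ord₃ qd ≤ 0` (`hqd`/`hvd`) for the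
minimal twist model `Wd = [1, -1, 0, -3718780017, 87288440474141]` (two engines: PARI j293586, PARI-free j294995 — `#Ш_an(Wd) = 4`); the LB3SUB certificate line
`S ≤ Sel^(3)(E/ℚ)`, `#S = 27` (`hS`/`hcardS`; j293463/j293581). IN THE KERNEL: everything else (Parts 24a–e: models, minimality, `Addv`,
(G) ∧ ss, `ρ̄₃` onto, `∏ c_ℓ = 4`, twist identities; here: the field and the Heegner hypothesis). Per pair; nothing booked.
[cite: JetchevSkinnerWan2017, §7.4.1–7.4.3 (pp. 29–31)] [cite: McCallumLMS1991, §1 Theorem (Kolyvagin), p. 296] [cite: GrossLMS1991, §1 (p. 235)]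
[cite: SilvermanAEC2009, Thm. X.4.2(a)] [cite: SchaeferStoll2004, §1 and §5] [cite: Miller2011LMS, §1 and Def. 1.1] [cite: Cremona2006, Table 1 (Cremona label 439794p1)] -/
theorem bsdp_g439794p1_3_ker
    (hGZ : ∀ (N : ℕ) [NeZero N] (W : WeierstrassCurve ℚ) (K : Type) [Field K] [NumberField K],
      gross_zagier N W K)
    (hKo : ∀ (N : ℕ) [NeZero N] (W : WeierstrassCurve ℚ) (K : Type) [Field K] [NumberField K],
      kolyvagin N W K)
    (hB : ∀ (N : ℕ) [NeZero N] (W : WeierstrassCurve ℚ) (K : Type) [Field K] [NumberField K],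
      Kolyvagin1990_padicValNat_card_sha_le N W K)
    (hGZK : rank_eq_analyticRank_of_analyticRank_le_one) (hmod : hasEntireLFunction_rat)
    (hnf : exists_isNewformOf) (hMz : mazur_not_dvd_maninConstant_of_odd)
    (hAU : abbesUllmo_not_dvd_maninConstant_of_not_dvd_level)
    (hC2 : cesnavicius_not_two_dvd_maninConstant_of_two_dvd_level)
    {W : WeierstrassCurve ℚ} [W.IsElliptic] [W.IsGloballyMinimal] (hWeq : W = ⟨1, -1, 0, -412053, -101704843⟩)
    (hr : W.analyticRank = 1) (hLt : (W.quadraticTwist (-95 : ℚ)).entireLFunction 1 ≠ 0)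
    {Wd : WeierstrassCurve ℚ} [Wd.IsElliptic] [Wd.IsGloballyMinimal] (hWdeq : Wd = ⟨1, -1, 0, -3718780017, 87288440474141⟩)
    {qd : ℚ} (hqd : shaAn Wd = (qd : ℂ)) (hvd : padicValRat 3 qd ≤ 0)
    {S : AddSubgroup (W.galH1Torsion (3 : ℤ))} (hS : S ≤ W.selmerGroup (3 : ℤ)) (hcardS : Nat.card S = 27)
    {q : ℚ} (hq : shaAn W = (q : ℂ)) (hv : padicValRat 3 q ≤ 2) : BSDp W 3 := by
  obtain ⟨K, _, _, hK, hdK⟩ := exists_field_g439794p1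
  have hHN : SatisfiesHeegnerHypothesis (W.conductorNorm ℤ) K := by subst hWeq; exact heegner_g439794p1 K hK hdK
  exact bsdp_g439794p1_3_tam hGZ hKo hB hGZK hmod hnf hMz hAU hC2 hWeq hr K hK hdK hHN hLt hWdeq hqd hvd hS hcardS hq hv

/-! ### `205128l1` — Heegner field `ℚ(√-887)`: `d_K = -887` fundamental; primes of `Δ` = `[2, 3, 7, 11, 37]` all split (`-887 ≡ 1 (mod 8)`, `(-887/3) = +1`, `(-887/7) = +1`, `(-887/11) = +1`, `(-887/37) = +1`) -/

/-- **The Heegner hypothesis for `(N_E, K)`, `E = 205128l1`, for EVERY imaginary quadratic `K` with `d_K = -887`**, IN THE KERNEL: every prime of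
`N_E` divides `Δ_min = Δ(E₀)` (`|Δ| = 2^10·3^6·7^7·11^10·37^2` kernel-checked), and at each of them the decomposition law gives a split prime
(`-887 ≡ 1 (mod 8)`, `(-887/3) = +1`, `(-887/7) = +1`, `(-887/11) = +1`, `(-887/37) = +1`; Jacobi symbols by `norm_num`) — bsd-jet's `KolyvaginDepthDoor.satisfiesHeegnerHypothesis_conductorNorm_of_intModel`.
[cite: GrossLMS1991, §1 (p. 235)] [cite: Marcus1977, Ch. 3 Thm. 25] [cite: SilvermanAEC2009, VII.5 Prop. 5.1 (a)] [cite: Cremona2006, Table 1 (Cremona label 205128l1)] -/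
theorem heegner_g205128l1 (K : Type) [Field K] [NumberField K] (hK : IsImaginaryQuadratic K) (hdK : NumberField.discr K = -887) :
    haveI := isElliptic_g205128l1; haveI := isGloballyMinimal_g205128l1
    SatisfiesHeegnerHypothesis ((⟨0, 0, 0, -140542659, -679555229778⟩ : WeierstrassCurve ℚ).conductorNorm ℤ) K := by
  haveI := isElliptic_g205128l1
  haveI := isGloballyMinimal_g205128l1
  have hIW : integralModelInt (⟨0, 0, 0, -140542659, -679555229778⟩ : WeierstrassCurve ℚ) = (⟨0, 0, 0, -140542659, -679555229778⟩ : WeierstrassCurve ℤ) :=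
    integralModelInt_eq_of_map_eq _ (map_mk_int 0 0 0 (-140542659) (-679555229778))
  refine KolyvaginDepthDoor.satisfiesHeegnerHypothesis_conductorNorm_of_intModel hIW K hK.1 hdK
    (forall_prime_dvd_of_natAbs_eq_prod [(2, 10), (3, 6), (7, 7), (11, 10), (37, 2)] (by decide +kernel)
      (by intro qe hqe; simp only [List.mem_cons, List.not_mem_nil, or_false] at hqe
          rcases hqe with rfl | rfl | rfl | rfl | rfl <;> norm_num)
      (by intro qe hqe; simp only [List.mem_cons, List.not_mem_nil, or_false] at hqe
          rcases hqe with rfl | rfl | rfl | rfl | rfl <;> norm_num))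

/-- **An imaginary quadratic field with `d_K = -887` EXISTS** (`-887` is a negative fundamental discriminant; squarefreeness by `decide`) —
bsd-jet's `KolyvaginDepthDoor.exists_isImaginaryQuadratic_discr_eq` (Marcus Ch. 2 Thm. 1). [cite: Marcus1977, Ch. 2 Thm. 1] [cite: Cremona2006, Table 1 (Cremona label 205128l1)] -/
theorem exists_field_g205128l1 :
    ∃ (K : Type) (_ : Field K) (_ : NumberField K), IsImaginaryQuadratic K ∧ NumberField.discr K = -887 :=
  KolyvaginDepthDoor.exists_isImaginaryQuadratic_discr_eq (by norm_num)
    (Or.inl ⟨by norm_num, Int.squarefree_natAbs.mp (by decide +kernel), by norm_num⟩)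

/-- **`BSD(E,3)` for `E = 205128l1`, Heegner field and Tamagawa binders DISCHARGED** — the GSS2 kernel record in its leanest form: Part 24e's
`bsdp_g205128l1_3_tam` with `K := ` a field of discriminant `-887` (`exists_field_g205128l1`) and the Heegner hypothesis `heegner_g205128l1`.
DISPLAYED (all that a desk prices): the published facts hGZ hKo hB hGZK hmod hnf (+ cite-only hMz hAU hC2); Cremona's `r_an = 1` (`hr`) and
`#Ш_an = 9` (`hq`/`hv`, `ord₃ ≤ 2`); the twist datum `L(E^{(-887)},1) ≠ 0` (`hLt`) and `#Ш_an(Wd) = qd`, `ord₃ qd ≤ 0` (`hqd`/`hvd`) for the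
minimal twist model `Wd = [0, 0, 0, -110574607278771, 474237200867982859134]` (two engines: PARI j293586, PARI-free j294995 — `#Ш_an(Wd) = 100`); the LB3SUB certificate line
`S ≤ Sel^(3)(E/ℚ)`, `#S = 27` (`hS`/`hcardS`; j293463/j293581). IN THE KERNEL: everything else (Parts 24a–e: models, minimality, `Addv`,
(G) ∧ ss, `ρ̄₃` onto, `∏ c_ℓ = 16`, twist identities; here: the field and the Heegner hypothesis). Per pair; nothing booked.
[cite: JetchevSkinnerWan2017, §7.4.1–7.4.3 (pp. 29–31)] [cite: McCallumLMS1991, §1 Theorem (Kolyvagin), p. 296] [cite: GrossLMS1991, §1 (p. 235)]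
[cite: SilvermanAEC2009, Thm. X.4.2(a)] [cite: SchaeferStoll2004, §1 and §5] [cite: Miller2011LMS, §1 and Def. 1.1] [cite: Cremona2006, Table 1 (Cremona label 205128l1)] -/
theorem bsdp_g205128l1_3_ker
    (hGZ : ∀ (N : ℕ) [NeZero N] (W : WeierstrassCurve ℚ) (K : Type) [Field K] [NumberField K],
      gross_zagier N W K)
    (hKo : ∀ (N : ℕ) [NeZero N] (W : WeierstrassCurve ℚ) (K : Type) [Field K] [NumberField K],
      kolyvagin N W K)
    (hB : ∀ (N : ℕ) [NeZero N] (W : WeierstrassCurve ℚ) (K : Type) [Field K] [NumberField K],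
      Kolyvagin1990_padicValNat_card_sha_le N W K)
    (hGZK : rank_eq_analyticRank_of_analyticRank_le_one) (hmod : hasEntireLFunction_rat)
    (hnf : exists_isNewformOf) (hMz : mazur_not_dvd_maninConstant_of_odd)
    (hAU : abbesUllmo_not_dvd_maninConstant_of_not_dvd_level)
    (hC2 : cesnavicius_not_two_dvd_maninConstant_of_two_dvd_level)
    {W : WeierstrassCurve ℚ} [W.IsElliptic] [W.IsGloballyMinimal] (hWeq : W = ⟨0, 0, 0, -140542659, -679555229778⟩)
    (hr : W.analyticRank = 1) (hLt : (W.quadraticTwist (-887 : ℚ)).entireLFunction 1 ≠ 0)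
    {Wd : WeierstrassCurve ℚ} [Wd.IsElliptic] [Wd.IsGloballyMinimal] (hWdeq : Wd = ⟨0, 0, 0, -110574607278771, 474237200867982859134⟩)
    {qd : ℚ} (hqd : shaAn Wd = (qd : ℂ)) (hvd : padicValRat 3 qd ≤ 0)
    {S : AddSubgroup (W.galH1Torsion (3 : ℤ))} (hS : S ≤ W.selmerGroup (3 : ℤ)) (hcardS : Nat.card S = 27)
    {q : ℚ} (hq : shaAn W = (q : ℂ)) (hv : padicValRat 3 q ≤ 2) : BSDp W 3 := by
  obtain ⟨K, _, _, hK, hdK⟩ := exists_field_g205128l1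
  have hHN : SatisfiesHeegnerHypothesis (W.conductorNorm ℤ) K := by subst hWeq; exact heegner_g205128l1 K hK hdK
  exact bsdp_g205128l1_3_tam hGZ hKo hB hGZK hmod hnf hMz hAU hC2 hWeq hr K hK hdK hHN hLt hWdeq hqd hvd hS hcardS hq hv

end Summit.BirchSwinnertonDyer.BirchSwinnertonDyer.Theorems.AdditiveBranchIMCGordTwoRankOne.HeegnerKolyvagin

end
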